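import Mathlib

/-!
# Gauss (`L · A · U = D`) decomposition for matrices with nonzero leading principal minors

Support file (pure linear algebra, no new facts) for the proof of Andrews–Forbes 2022,
Proposition 3.5 (`BideterminantReduction.lean`, proof in `BideterminantReductionProofs.lean`).
The printed proof of Prop. 3.5 goes through the straightening law; the tree's proof replaces it
by highest-weight theory for `GL_n × GL_m` acting on `𝔽[X]`, whose key input is the classical
"big cell" statement: a square matrix all of whose leading principal minors are invertible is
`L⁻¹ · D · U⁻¹` with `L` lower unitriangular, `U` upper unitriangular and `D` diagonal (Gauss
elimination without pivoting). This file proves exactly that, by induction on the size through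
Mathlib's Schur-complement block identities, together with the bookkeeping lemma saying that the
top-left `a × b` corner of `L · M · U` is `L_{[a]} · M_{[a],[b]} · U_{[b]}` for triangular `L, U`.

## Contents

* `AndrewsForbes.sum_eq_sum_castLE` — a sum over `Fin n` of a function vanishing from index `a` on
  is a sum over `Fin a`.
* `AndrewsForbes.submatrix_mul_mul_castLE` — corners of `L · M · U` (`L` lower, `U` upper triangular).
* `AndrewsForbes.det_corner_eq_one_of_lower/upper` — corners of unitriangular matrices have
  determinant `1`; `AndrewsForbes.det_corner_diagonal`.
* `AndrewsForbes.exists_lower_mul_mul_upper_eq_diagonal` — the `LDU` statement over a field.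

## References

Standard linear algebra (Gauss elimination; e.g. Horn–Johnson, *Matrix Analysis*, §3.5,
`LDU` factorisation). [folklore]
-/

namespace Literature.Computability.AlgebraicComplexity.AndrewsForbes

open Matrix

section Corner

variable {R : Type*} [CommRing R]

/-- A sum over `Fin n` of a function vanishing at all indices `≥ a` equals the sum of its values on
the initial segment `Fin a ↪ Fin n`. [folklore] -/
theorem sum_eq_sum_castLE {M : Type*} [AddCommMonoid M] {a n : ℕ} (ha : a ≤ n) (g : Fin n → M)
    (hg : ∀ x : Fin n, a ≤ (x : ℕ) → g x = 0) :
    ∑ x, g x = ∑ i : Fin a, g (Fin.castLE ha i) := by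
  have hmap : ∑ i : Fin a, g (Fin.castLE ha i) = ∑ x ∈ Finset.univ.map (Fin.castLEEmb ha), g x := by
    rw [Finset.sum_map]
    rfl
  rw [hmap]
  refine (Finset.sum_subset (Finset.subset_univ _) fun x _ hx => hg x ?_).symm
  by_contra h
  push Not at h
  exact hx (Finset.mem_map.mpr ⟨⟨x, h⟩, Finset.mem_univ _, Fin.ext rfl⟩)

/-- **Corner lemma.** For `L` lower triangular (`n × n`), `U` upper triangular (`m × m`) and any
`n × m` matrix `M`, the top-left `a × b` corner of `L · M · U` is the product of the corners
`L_{[a],[a]} · M_{[a],[b]} · U_{[b],[b]}`. [folklore] -/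
theorem submatrix_mul_mul_castLE {n m a b : ℕ} (L : Matrix (Fin n) (Fin n) R)
    (M : Matrix (Fin n) (Fin m) R) (U : Matrix (Fin m) (Fin m) R)
    (hL : L.BlockTriangular OrderDual.toDual) (hU : U.BlockTriangular id)
    (ha : a ≤ n) (hb : b ≤ m) :
    (L * M * U).submatrix (Fin.castLE ha) (Fin.castLE hb) =
      L.submatrix (Fin.castLE ha) (Fin.castLE ha) * M.submatrix (Fin.castLE ha) (Fin.castLE hb) *
        U.submatrix (Fin.castLE hb) (Fin.castLE hb) := by
  ext i j
  simp only [submatrix_apply, mul_apply]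
  rw [sum_eq_sum_castLE hb _ ?_]
  · refine Finset.sum_congr rfl fun y _ => ?_
    rw [sum_eq_sum_castLE ha _ ?_]
    intro x hx
    have hlt : Fin.castLE ha i < x := by
      rw [Fin.lt_def]
      exact lt_of_lt_of_le i.2 hx
    rw [hL (show OrderDual.toDual x < OrderDual.toDual (Fin.castLE ha i) from hlt), zero_mul]
  · intro y hy
    have hlt : Fin.castLE hb j < y := by
      rw [Fin.lt_def]
      exact lt_of_lt_of_le j.2 hy
    rw [hU (show id (Fin.castLE hb j) < id y from hlt), mul_zero]

/-- A corner of a lower unitriangular matrix has determinant `1`. [folklore] -/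
theorem det_corner_eq_one_of_lower {n k : ℕ} (L : Matrix (Fin n) (Fin n) R)
    (hL : L.BlockTriangular OrderDual.toDual) (hd : ∀ i, L i i = 1) (hk : k ≤ n) :
    (L.submatrix (Fin.castLE hk) (Fin.castLE hk)).det = 1 := by
  rw [det_of_lowerTriangular _ ?_]
  · simp only [submatrix_apply, hd, Finset.prod_const_one]
  · intro i j hij
    exact hL (show OrderDual.toDual (Fin.castLE hk j) < OrderDual.toDual (Fin.castLE hk i) from
      OrderDual.toDual_lt_toDual.mpr
        (Fin.lt_def.mpr (Fin.lt_def.mp (OrderDual.toDual_lt_toDual.mp hij))))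

/-- A corner of an upper unitriangular matrix has determinant `1`. [folklore] -/
theorem det_corner_eq_one_of_upper {n k : ℕ} (U : Matrix (Fin n) (Fin n) R)
    (hU : U.BlockTriangular id) (hd : ∀ i, U i i = 1) (hk : k ≤ n) :
    (U.submatrix (Fin.castLE hk) (Fin.castLE hk)).det = 1 := by
  rw [det_of_upperTriangular ?_]
  · simp only [submatrix_apply, hd, Finset.prod_const_one]
  · intro i j hij
    exact hU (show id (Fin.castLE hk j) < id (Fin.castLE hk i) from
      Fin.lt_def.mpr (Fin.lt_def.mp hij))

/-- The `a × b` corner of a square diagonal matrix. [folklore] -/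
theorem corner_diagonal {s a b : ℕ} (δ : Fin s → R) (ha : a ≤ s) (hb : b ≤ s) :
    (diagonal δ).submatrix (Fin.castLE ha) (Fin.castLE hb) =
      of fun (i : Fin a) (j : Fin b) => if (i : ℕ) = (j : ℕ) then δ (Fin.castLE ha i) else 0 := by
  ext i j
  simp only [submatrix_apply, diagonal_apply, of_apply, Fin.ext_iff, Fin.val_castLE]

/-- The square `k × k` corner of a square diagonal matrix has determinant the product of the first
`k` diagonal entries. [folklore] -/
theorem det_corner_diagonal {s k : ℕ} (δ : Fin s → R) (hk : k ≤ s) :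
    ((diagonal δ).submatrix (Fin.castLE hk) (Fin.castLE hk)).det = ∏ i : Fin k, δ (Fin.castLE hk i) := by
  have : (diagonal δ).submatrix (Fin.castLE hk) (Fin.castLE hk) =
      diagonal fun i : Fin k => δ (Fin.castLE hk i) := by
    ext i j
    simp only [submatrix_apply, diagonal_apply, (Fin.castLE_injective hk).eq_iff]
  rw [this, det_diagonal]

end Corner

section LDU

variable {K : Type*} [Field K]

/-- **Gauss elimination without pivoting (`LDU`).** A square matrix over a field all of whose
leading principal minors are nonzero can be brought to diagonal form by a lower unitriangular
matrix acting on the left and an upper unitriangular matrix acting on the right: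
`L · A · U = diagonal δ`. Proof by induction on the size, peeling off the last row and column with the
Schur complement of the (invertible) leading block. [folklore] -/
theorem exists_lower_mul_mul_upper_eq_diagonal : ∀ (s : ℕ) (A : Matrix (Fin s) (Fin s) K),
    (∀ k (hk : k ≤ s), (A.submatrix (Fin.castLE hk) (Fin.castLE hk)).det ≠ 0) →
    ∃ (L U : Matrix (Fin s) (Fin s) K) (δ : Fin s → K),
      L.BlockTriangular OrderDual.toDual ∧ (∀ i, L i i = 1) ∧
      U.BlockTriangular id ∧ (∀ i, U i i = 1) ∧ L * A * U = diagonal δ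
  | 0, A, _ => ⟨1, 1, fun i => i.elim0, blockTriangular_one, fun i => i.elim0,
      blockTriangular_one, fun i => i.elim0, by ext i; exact i.elim0⟩
  | s + 1, A, hA => by
    -- the leading `s × s` block and the induction hypothesis
    set A' : Matrix (Fin s) (Fin s) K := A.submatrix Fin.castSucc Fin.castSucc with hA'def
    have hcast : ∀ k (hk : k ≤ s),
        (Fin.castSucc ∘ Fin.castLE hk : Fin k → Fin (s + 1)) = Fin.castLE (hk.trans s.le_succ) :=
      fun k hk => funext fun i => Fin.ext rfl
    have hA' : ∀ k (hk : k ≤ s), (A'.submatrix (Fin.castLE hk) (Fin.castLE hk)).det ≠ 0 := by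
      intro k hk
      have h := hA k (hk.trans s.le_succ)
      rwa [hA'def, submatrix_submatrix, hcast k hk]
    obtain ⟨L', U', δ', hL't, hL'd, hU't, hU'd, hLAU'⟩ :=
      exists_lower_mul_mul_upper_eq_diagonal s A' hA'
    have hdetA' : A'.det ≠ 0 := by
      have h := hA' s le_rfl
      have hid : (Fin.castLE (le_refl s) : Fin s → Fin s) = id := funext fun i => Fin.ext rfl
      rwa [hid, submatrix_id_id] at h
    letI : Invertible A' := invertibleOfIsUnitDet A' (Ne.isUnit hdetA')
    -- block form of `A`
    let e : Fin s ⊕ Fin 1 ≃ Fin (s + 1) := finSumFinEquiv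
    let B : Matrix (Fin s) (Fin 1) K := A.submatrix Fin.castSucc fun _ => Fin.last s
    let C : Matrix (Fin 1) (Fin s) K := A.submatrix (fun _ => Fin.last s) Fin.castSucc
    let D : Matrix (Fin 1) (Fin 1) K := A.submatrix (fun _ => Fin.last s) fun _ => Fin.last s
    have he_inl : ∀ i : Fin s, e (Sum.inl i) = Fin.castSucc i := fun i => rfl
    have he_inr : ∀ i : Fin 1, e (Sum.inr i) = Fin.last s := by
      intro i
      obtain rfl : i = 0 := Subsingleton.elim i 0
      exact Fin.ext (by simp [e])
    have hblocks : A.submatrix e e = fromBlocks A' B C D := by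
      ext (i | i) (j | j) <;>
        simp only [submatrix_apply, he_inl, he_inr, fromBlocks_apply₁₁, fromBlocks_apply₁₂,
          fromBlocks_apply₂₁, fromBlocks_apply₂₂, hA'def, B, C, D]
    -- Schur complement step: clear the last row and column
    let S : Matrix (Fin 1) (Fin 1) K := D - C * ⅟A' * B
    let P : Matrix (Fin s ⊕ Fin 1) (Fin s ⊕ Fin 1) K := fromBlocks 1 0 (-(C * ⅟A')) 1
    let Q : Matrix (Fin s ⊕ Fin 1) (Fin s ⊕ Fin 1) K := fromBlocks 1 (-(⅟A' * B)) 0 1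
    have hPQ : P * fromBlocks A' B C D * Q = fromBlocks A' 0 0 S := by
      simp only [P, Q, S, fromBlocks_multiply, Matrix.mul_zero, Matrix.zero_mul, Matrix.one_mul,
        Matrix.mul_one, add_zero, Matrix.neg_mul, Matrix.mul_neg,
        Matrix.invOf_mul_cancel_right, Matrix.mul_invOf_cancel_left, neg_add_cancel]
      congr 1; abel
    -- the induction hypothesis on the leading block
    let EL : Matrix (Fin s ⊕ Fin 1) (Fin s ⊕ Fin 1) K := fromBlocks L' 0 0 1
    let EU : Matrix (Fin s ⊕ Fin 1) (Fin s ⊕ Fin 1) K := fromBlocks U' 0 0 1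
    have hS : S = diagonal fun _ : Fin 1 => S 0 0 := by
      ext i j
      obtain rfl : i = 0 := Subsingleton.elim i 0
      obtain rfl : j = 0 := Subsingleton.elim j 0
      simp
    have hE : EL * (fromBlocks A' 0 0 S) * EU = diagonal (Sum.elim δ' fun _ => S 0 0) := by
      have h1 : EL * (fromBlocks A' 0 0 S) * EU = fromBlocks (L' * A' * U') 0 0 S := by
        simp only [EL, EU, fromBlocks_multiply, Matrix.mul_zero, Matrix.zero_mul, Matrix.one_mul,
          Matrix.mul_one, add_zero, zero_add]
      rw [h1, hLAU', ← fromBlocks_diagonal, ← hS]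
    have hELP : EL * P = fromBlocks L' 0 (-(C * ⅟A')) 1 := by
      simp only [EL, P, fromBlocks_multiply, Matrix.mul_zero, Matrix.zero_mul, Matrix.one_mul,
        Matrix.mul_one, add_zero, zero_add]
    have hQEU : Q * EU = fromBlocks U' (-(⅟A' * B)) 0 1 := by
      simp only [EU, Q, fromBlocks_multiply, Matrix.mul_zero, Matrix.zero_mul, Matrix.one_mul,
        Matrix.mul_one, add_zero, zero_add]
    -- total product
    have htotal : (EL * P) * A.submatrix e e * (Q * EU) = diagonal (Sum.elim δ' fun _ => S 0 0) := by
      rw [hblocks, ← hE, ← hPQ]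
      simp only [Matrix.mul_assoc]
    have hval_inl : ∀ i : Fin s, ((e (Sum.inl i) : Fin (s + 1)) : ℕ) = i := fun i => rfl
    have hval_inr : ∀ i : Fin 1, ((e (Sum.inr i) : Fin (s + 1)) : ℕ) = s := fun i => by
      rw [he_inr]; rfl
    refine ⟨(EL * P).submatrix e.symm e.symm, (Q * EU).submatrix e.symm e.symm,
      (Sum.elim δ' fun _ => S 0 0) ∘ e.symm, ?_, ?_, ?_, ?_, ?_⟩
    · -- `L` lower triangular
      intro i j hij
      obtain ⟨x, rfl⟩ := e.surjective i
      obtain ⟨y, rfl⟩ := e.surjective j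
      have hlt : ((e x : Fin (s + 1)) : ℕ) < ((e y : Fin (s + 1)) : ℕ) :=
        Fin.lt_def.mp (OrderDual.toDual_lt_toDual.mp hij)
      simp only [submatrix_apply, Equiv.symm_apply_apply, hELP]
      rcases x with x | x <;> rcases y with y | y
      · simp only [fromBlocks_apply₁₁]
        rw [hval_inl, hval_inl] at hlt
        exact hL't (show OrderDual.toDual y < OrderDual.toDual x from Fin.lt_def.mpr hlt)
      · simp only [fromBlocks_apply₁₂, Matrix.zero_apply]
      · rw [hval_inr, hval_inl] at hlt
        exact absurd hlt (not_lt.mpr y.2.le)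
      · rw [hval_inr, hval_inr] at hlt
        exact absurd hlt (lt_irrefl _)
    · -- `L` has unit diagonal
      intro i
      obtain ⟨x, rfl⟩ := e.surjective i
      simp only [submatrix_apply, Equiv.symm_apply_apply, hELP]
      rcases x with x | x
      · simp only [fromBlocks_apply₁₁, hL'd]
      · simp only [fromBlocks_apply₂₂]
        obtain rfl : x = 0 := Subsingleton.elim x 0
        simp
    · -- `U` upper triangular
      intro i j hij
      obtain ⟨x, rfl⟩ := e.surjective i
      obtain ⟨y, rfl⟩ := e.surjective j
      have hlt : ((e y : Fin (s + 1)) : ℕ) < ((e x : Fin (s + 1)) : ℕ) := Fin.lt_def.mp hij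
      simp only [submatrix_apply, Equiv.symm_apply_apply, hQEU]
      rcases x with x | x <;> rcases y with y | y
      · simp only [fromBlocks_apply₁₁]
        rw [hval_inl, hval_inl] at hlt
        exact hU't (show id y < id x from Fin.lt_def.mpr hlt)
      · rw [hval_inr, hval_inl] at hlt
        exact absurd hlt (not_lt.mpr x.2.le)
      · simp only [fromBlocks_apply₂₁, Matrix.zero_apply]
      · rw [hval_inr, hval_inr] at hlt
        exact absurd hlt (lt_irrefl _)
    · -- `U` has unit diagonal
      intro i
      obtain ⟨x, rfl⟩ := e.surjective i
      simp only [submatrix_apply, Equiv.symm_apply_apply, hQEU]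
      rcases x with x | x
      · simp only [fromBlocks_apply₁₁, hU'd]
      · simp only [fromBlocks_apply₂₂]
        obtain rfl : x = 0 := Subsingleton.elim x 0
        simp
    · -- the product
      have hAe : A = (A.submatrix e e).submatrix e.symm e.symm := by
        simp only [submatrix_submatrix, Equiv.self_comp_symm, submatrix_id_id]
      conv_lhs => rw [hAe]
      rw [submatrix_mul_equiv, submatrix_mul_equiv, htotal, submatrix_diagonal_equiv]

end LDU

end Literature.Computability.AlgebraicComplexity.AndrewsForbes
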